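import Summits.QuantumFields.BalabanUV.Beta.GAN24.DirichletVertexLocal

/-!
# `BalabanUV.Beta.GAN24.DirichletVertexLocalT` — binder row G-an2-4 / (CONV-C), road P2 PART IV, leaf L14 (the torus transfer), FILE C2τ:
# THE UNWEIGHTED HESSIAN ON A TRANSLATED WINDOW (centre `n·b + τ`, product region), ON THE TORUS, `d = 2`
# (unit b2b-balaban-gan24-p2, gen 26, v1)

HONEST FRAMING (cell contract, verbatim): «discharging `BetaPertH` makes Bałaban's UV stability UNCONDITIONAL — a real constructive-QFT
result; it is NOT the continuum limit and NOT the Clay problem.»  SUPPLIER module under the T⁴-DAG sub-row `T4-U1a.S-NE2-D1-DIRICHLET°`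
(owner wording R24 «the full rate L⁻¹ beyond boxes OPEN»).  The vertex census of binder (A) uses windows centred at ALL points `n·b + τ`,
`τ ∈ {0, q, 2q, 3q}²` (`q = ⌊n/4⌋`), so that every site is within plateau distance of some centre; for `τ ≠ 0` the window sees at most two
ADJACENT blocks of the star of `b` (or one), so its region is a PRODUCT whatever `S` is.  `DirichletVertexLocal` (p244863) did the corner
windows `τ = 0`; this file does the TRANSLATED windows: the translated pull-back `UpT u τ₀ τ₁ (i, j) = Up u (i+τ₀, j+τ₁)`, the translated
product region `WprodT A B τ₀ τ₁`, and the same chain (`local_hessian_le_shift` p244818 → window quantities → push-forward `plainWT`).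

## Contents ([folklore]; 0 sorry)
* §1 `UpT`, `d1/d2/lap` of the translate, the dictionary at `emb σ b (i+τ₀) (j+τ₁)`; `WprodT`, `axisSep_WprodT`, `blockReg_embT_iff`.
* §2 window sums of the translate are sub-sums of the torus sums (translated boxes, `emb_injOn`).
* §3 **`vertexT_local_hessian_le`**, push-forward `plainWT`, **`vertexT_plain_hessian_le`**, **`plainT_hessian_solExt_le`**:
  `Σ_μ Σ_x plainWT_{b,τ}(x)·|(∂ᴴ_μ∂_μ u_f)(x)|² ≤ (4(1+(a′γ′⁻¹)²) + 32(n/L)²γ′⁻¹ + 16(n/L)⁴γ′⁻²)·‖f‖²` for `1 ≤ L`, `K = 4L+c+1`,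
  `|τ_ν| + K + 1 ≤ n`, `2 ≤ M_ν`, and the product hypothesis `S (starBlk σ b p) ↔ A (p 0) ∧ B (p 1)` read on the window through `τ`.

ABSOLUTE RULE (cell, verbatim): «No internally-minted statement may enter as a cited fact. Every hypothesis is either kernel-proved in
this package or a verbatim quotation of a PUBLISHED theorem with page reference. The manuscript(s) under audit are NOT citable for
their own disputed steps — they are the thing under adjudication; programme-internal (2001/route/tribunal) claims are never citable.»
Nothing printed is a hypothesis.  NOT CLAIMED: the checkerboard corners, the coverage, `ω ≤ w′`, (Φ)/(Φ′), the END; NOT NE2, (CONV-C),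
`BetaPertH`, continuum, Clay.  «not in print; our proof attempt».  HONEST DEPENDENCY: continuum YM on T⁴ ⇐ BetaPertH ∧ nine spine
estimates (0/9 proved); BetaPertH ⇐ (D1) ∧ (D4) ∧ CAP+tail; G-an2-4 gates asym, D1 and NE2/3/4.
-/

noncomputable section

open scoped BigOperators ComplexConjugate Matrix
open Finset

namespace Summit.QuantumFields.BalabanUV.Beta.GAN24.DirichletVertexLocalT

open Literature.MathematicalPhysics.QuantumFieldTheory.Balaban1983to89.B5Prop11Plancherel (Tor fine unitVec)
open Literature.MathematicalPhysics.QuantumFieldTheory.Balaban1983to89.B5Action121 (sdiff LapS)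
open Literature.MathematicalPhysics.QuantumFieldTheory.Balaban1983to89.B5Prop11Lower (nsq nsq_nonneg)
open Summit.QuantumFields.BalabanUV.T4Continuum.ScalarAveragedPropagator (gammaPs gammaPs_pos dirichlet)
open Summit.QuantumFields.BalabanUV.Beta.GAN24.DirichletBoxRegularity (Pdir)
open Summit.QuantumFields.BalabanUV.Beta.GAN24.DirichletBoxTrace (blockReg)
open Summit.QuantumFields.BalabanUV.Beta.GAN24.DirichletBoxCompression (solExt solExt_apply_of_not dirichlet_solExt_le
  sum_normSq_LapS_solExt_le nsq_solExt_le)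
open DirichletRingEnergies (hb vb lap Et sqSum Et_nonneg sqSum_nonneg hb_nonneg vb_nonneg)
open DirichletRingCutoff (tIdx one_le_tIdx)
open DirichletRingHessianIdentity (d1 d2)
open DirichletRingHessianLocal (AxisSep indW indW_mem axisSep_prod)
open DirichletRingHessianLocalShift (local_hessian_le_shift)
open DirichletVertexChart
open DirichletVertexPullback
open DirichletVertexLocal (Wprod blockReg_emb_iff_Wprod)

variable (n : ℕ) [NeZero n] (M : Fin 2 → ℕ) [hM : ∀ μ, NeZero (M μ)]

/-! ## §1 The translated pull-back and the translated product region -/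

/-- the TRANSLATED PULL-BACK: `UpT u τ₀ τ₁ (i, j) = u (emb σ b (i+τ₀) (j+τ₁))`. [folklore] -/
def UpT (σ : Fin 2 → Bool) (b : Tor M) (u : Tor (fine n M) → ℂ) (τ₀ τ₁ : ℤ) (i j : ℤ) : ℂ := Up n M σ b u (i + τ₀) (j + τ₁)

section Translate

variable (σ : Fin 2 → Bool) (b : Tor M) (u : Tor (fine n M) → ℂ) (τ₀ τ₁ : ℤ)

omit [NeZero n] hM in
/-- `d1` commutes with translation. [folklore] -/
theorem d1_UpT (i j : ℤ) : d1 (UpT n M σ b u τ₀ τ₁) i j = d1 (Up n M σ b u) (i + τ₀) (j + τ₁) := by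
  simp only [d1, UpT]
  ring_nf

omit [NeZero n] hM in
/-- `d2` commutes with translation. [folklore] -/
theorem d2_UpT (i j : ℤ) : d2 (UpT n M σ b u τ₀ τ₁) i j = d2 (Up n M σ b u) (i + τ₀) (j + τ₁) := by
  simp only [d2, UpT]
  ring_nf

omit [NeZero n] hM in
/-- `lap` commutes with translation. [folklore] -/
theorem lap_UpT (i j : ℤ) : lap (UpT n M σ b u τ₀ τ₁) i j = lap (Up n M σ b u) (i + τ₀) (j + τ₁) := by
  simp only [lap, UpT]
  ring_nf

omit [NeZero n] hM in
/-- `hb` of the translate. [folklore] -/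
theorem hb_UpT (i j : ℤ) : hb (UpT n M σ b u τ₀ τ₁) i j = hb (Up n M σ b u) (i + τ₀) (j + τ₁) := by
  simp only [hb, UpT]
  ring_nf

omit [NeZero n] hM in
/-- `vb` of the translate. [folklore] -/
theorem vb_UpT (i j : ℤ) : vb (UpT n M σ b u τ₀ τ₁) i j = vb (Up n M σ b u) (i + τ₀) (j + τ₁) := by
  simp only [vb, UpT]
  ring_nf

/-- the dictionary on the translated window, first axis. [folklore] -/
theorem Pdir_embT_fst (i j : ℤ) :
    (Pdir (fine n M) (n : ℂ) 0 *ᵥ u) (emb n M σ b (i + τ₀) (j + τ₁)) = -(n : ℂ) ^ 2 * d1 (UpT n M σ b u τ₀ τ₁) i j := by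
  rw [Pdir_emb_fst, d1_UpT]

/-- second axis. [folklore] -/
theorem Pdir_embT_snd (i j : ℤ) :
    (Pdir (fine n M) (n : ℂ) 1 *ᵥ u) (emb n M σ b (i + τ₀) (j + τ₁)) = -(n : ℂ) ^ 2 * d2 (UpT n M σ b u τ₀ τ₁) i j := by
  rw [Pdir_emb_snd, d2_UpT]

end Translate

/-- the TRANSLATED PRODUCT REGION `W(i,j) ↔ A(0 ≤ i+τ₀) ∧ B(0 ≤ j+τ₁)`. [folklore] -/
def WprodT (A B : Bool → Prop) (τ₀ τ₁ : ℤ) (i j : ℤ) : Prop := A (decide (0 ≤ i + τ₀)) ∧ B (decide (0 ≤ j + τ₁))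

/-- decidability. [folklore] -/
instance decWprodT (A B : Bool → Prop) [DecidablePred A] [DecidablePred B] (τ₀ τ₁ i j : ℤ) : Decidable (WprodT A B τ₀ τ₁ i j) :=
  inferInstanceAs (Decidable (A (decide (0 ≤ i + τ₀)) ∧ B (decide (0 ≤ j + τ₁))))

omit hM in
/-- the translated product region is axis-separated. [folklore] -/
theorem axisSep_WprodT (A B : Bool → Prop) (τ₀ τ₁ : ℤ) : AxisSep (WprodT A B τ₀ τ₁) :=
  axisSep_prod (fun i => A (decide (0 ≤ i + τ₀))) (fun j => B (decide (0 ≤ j + τ₁)))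

omit hM in
/-- `WprodT` is `Wprod` translated. [folklore] -/
theorem WprodT_iff (A B : Bool → Prop) (τ₀ τ₁ i j : ℤ) : WprodT A B τ₀ τ₁ i j ↔ Wprod A B (i + τ₀) (j + τ₁) := Iff.rfl

section Region

variable {S : Tor M → Prop} {σ : Fin 2 → Bool} {b : Tor M} {A B : Bool → Prop}

/-- on the translated window, `emb σ b (i+τ₀) (j+τ₁) ∈ Ω ↔ WprodT A B τ₀ τ₁ i j`. [folklore] -/
theorem blockReg_embT_iff (hAB : ∀ p : Fin 2 → Bool, S (starBlk M σ b p) ↔ A (p 0) ∧ B (p 1)) {τ₀ τ₁ i j : ℤ}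
    (hi : -(n : ℤ) ≤ i + τ₀) (hi' : i + τ₀ < n) (hj : -(n : ℤ) ≤ j + τ₁) (hj' : j + τ₁ < n) :
    blockReg n M S (emb n M σ b (i + τ₀) (j + τ₁)) ↔ WprodT A B τ₀ τ₁ i j := by
  rw [WprodT_iff]
  exact blockReg_emb_iff_Wprod n M hAB hi hi' hj hj'

end Region

/-! ## §2 Window sums of the translate -/

section Sums

variable {S : Tor M → Prop} {σ : Fin 2 → Bool} {b : Tor M} {A B : Bool → Prop} [DecidablePred A] [DecidablePred B]
  {u : Tor (fine n M) → ℂ} {τ₀ τ₁ : ℤ}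

/-- `𝟙_W`-weighted square-sum over the translated window `Q_K + τ` of `‖F ∘ emb‖²` is a sub-sum of `Σ_{x∈Ω}‖F x‖²`. [folklore] -/
theorem sqSum_indWT_le [DecidablePred S] (hAB : ∀ p : Fin 2 → Bool, S (starBlk M σ b p) ↔ A (p 0) ∧ B (p 1))
    (F : Tor (fine n M) → ℂ) {K : ℕ} (hτ₀ : -(n : ℤ) + K ≤ τ₀) (hτ₀' : τ₀ + K ≤ n) (hτ₁ : -(n : ℤ) + K ≤ τ₁) (hτ₁' : τ₁ + K ≤ n)
    (h0 : 2 * K ≤ n * M 0) (h1 : 2 * K ≤ n * M 1) :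
    sqSum (fun i j => indW (WprodT A B τ₀ τ₁) i j * ‖F (emb n M σ b (i + τ₀) (j + τ₁))‖ ^ 2) K
      ≤ ∑ x ∈ univ.filter (blockReg n M S), ‖F x‖ ^ 2 := by
  set P : Tor (fine n M) → ℝ := fun x => if blockReg n M S x then ‖F x‖ ^ 2 else 0 with hP
  have hP0 : ∀ x, 0 ≤ P x := fun x => by rw [hP]; simp only; split_ifs <;> positivity
  have hterm : ∀ t ∈ range (2 * K), ∀ s ∈ range (2 * K),
      indW (WprodT A B τ₀ τ₁) (-(K : ℤ) + s) (-(K : ℤ) + t) * ‖F (emb n M σ b (-(K : ℤ) + s + τ₀) (-(K : ℤ) + t + τ₁))‖ ^ 2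
        ≤ P (emb n M σ b (-(K : ℤ) + s + τ₀) (-(K : ℤ) + t + τ₁)) := by
    intro t ht s hs
    simp only [mem_range] at ht hs
    rw [indW, hP]
    simp only
    have hiff := blockReg_embT_iff n M hAB (τ₀ := τ₀) (τ₁ := τ₁) (i := -(K : ℤ) + s) (j := -(K : ℤ) + t)
      (by omega) (by omega) (by omega) (by omega)
    by_cases hW : WprodT A B τ₀ τ₁ (-(K : ℤ) + s) (-(K : ℤ) + t)
    · rw [if_pos hW, if_pos (hiff.mpr hW), one_mul]
    · rw [if_neg hW, zero_mul]; split_ifs <;> positivity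
  calc sqSum (fun i j => indW (WprodT A B τ₀ τ₁) i j * ‖F (emb n M σ b (i + τ₀) (j + τ₁))‖ ^ 2) K
      ≤ ∑ t ∈ range (2 * K), ∑ s ∈ range (2 * K), P (emb n M σ b (-(K : ℤ) + s + τ₀) (-(K : ℤ) + t + τ₁)) :=
        sum_le_sum fun t ht => sum_le_sum fun s hs => hterm t ht s hs
    _ ≤ ∑ x, P x := by
        refine sum_sum_le_univ_of_injOn n M (fun t s => emb n M σ b (-(K : ℤ) + s + τ₀) (-(K : ℤ) + t + τ₁)) P hP0 ?_
        intro t ht s hs t' ht' s' hs' h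
        simp only [mem_range] at ht hs ht' hs'
        have := emb_injOn n M (σ := σ) (b := b) (a₀ := -(K : ℤ) + τ₀) (a₁ := -(K : ℤ) + τ₁) (W₀ := 2 * K) (W₁ := 2 * K) h0 h1
          (i := -(K : ℤ) + s + τ₀) (j := -(K : ℤ) + t + τ₁) (i' := -(K : ℤ) + s' + τ₀) (j' := -(K : ℤ) + t' + τ₁)
          (by omega) (by omega) (by omega) (by omega) (by omega) (by omega) (by omega) (by omega) h
        omega
    _ = _ := by rw [hP, sum_filter]

/-- the site square-sum of the translate over `Q_K` is a sub-sum of `nsq u`. [folklore] -/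
theorem sqSum_normSq_UpT_le (u : Tor (fine n M) → ℂ) {K : ℕ} (h0 : 2 * K ≤ n * M 0) (h1 : 2 * K ≤ n * M 1) :
    sqSum (fun i j => ‖UpT n M σ b u τ₀ τ₁ i j‖ ^ 2) K ≤ nsq u := by
  rw [nsq]
  refine sum_sum_le_univ_of_injOn n M (fun t s => emb n M σ b (-(K : ℤ) + s + τ₀) (-(K : ℤ) + t + τ₁)) (fun x => ‖u x‖ ^ 2)
    (fun _ => sq_nonneg _) ?_
  intro t ht s hs t' ht' s' hs' h
  simp only [mem_range] at ht hs ht' hs'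
  have := emb_injOn n M (σ := σ) (b := b) (a₀ := -(K : ℤ) + τ₀) (a₁ := -(K : ℤ) + τ₁) (W₀ := 2 * K) (W₁ := 2 * K) h0 h1
    (i := -(K : ℤ) + s + τ₀) (j := -(K : ℤ) + t + τ₁) (i' := -(K : ℤ) + s' + τ₀) (j' := -(K : ℤ) + t' + τ₁)
    (by omega) (by omega) (by omega) (by omega) (by omega) (by omega) (by omega) (by omega) h
  omega

/-- the horizontal ring energy of the translate is a sub-sum of `‖∂₀u‖²/n²`. [folklore] -/
theorem EtH_UpT_le (u : Tor (fine n M) → ℂ) {K : ℕ} (h0 : 2 * K + 2 ≤ n * M 0) (h1 : 2 * K ≤ n * M 1) :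
    EtH (UpT n M σ b u τ₀ τ₁) K ≤ nsq (sdiff (fine n M) (n : ℂ) 0 *ᵥ u) / (n : ℝ) ^ 2 := by
  have hn : (0 : ℝ) < (n : ℝ) ^ 2 := pow_pos (by exact_mod_cast Nat.pos_of_ne_zero (NeZero.ne n)) 2
  have hb01 := bsh_mem σ 0
  rw [EtH]
  simp only [hb_UpT, hb_Up_eq, ← sum_div]
  refine div_le_div_of_nonneg_right ?_ hn.le
  rw [nsq]
  refine sum_sum_le_univ_of_injOn n M (fun t s => emb n M σ b (-(K : ℤ) - 1 + s + τ₀ + bsh σ 0) (-(K : ℤ) + t + τ₁))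
    (fun x => ‖_‖ ^ 2) (fun _ => sq_nonneg _) ?_
  intro t ht s hs t' ht' s' hs' h
  simp only [mem_range] at ht hs ht' hs'
  have := emb_injOn n M (σ := σ) (b := b) (a₀ := -(K : ℤ) - 1 + τ₀ + bsh σ 0) (a₁ := -(K : ℤ) + τ₁) (W₀ := 2 * K + 2) (W₁ := 2 * K)
    h0 h1 (i := -(K : ℤ) - 1 + s + τ₀ + bsh σ 0) (j := -(K : ℤ) + t + τ₁) (i' := -(K : ℤ) - 1 + s' + τ₀ + bsh σ 0)
    (j' := -(K : ℤ) + t' + τ₁) (by omega) (by omega) (by omega) (by omega) (by omega) (by omega) (by omega) (by omega) h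
  omega

/-- the vertical ring energy of the translate is a sub-sum of `‖∂₁u‖²/n²`. [folklore] -/
theorem EtV_UpT_le (u : Tor (fine n M) → ℂ) {K : ℕ} (h0 : 2 * K ≤ n * M 0) (h1 : 2 * K + 2 ≤ n * M 1) :
    EtV (UpT n M σ b u τ₀ τ₁) K ≤ nsq (sdiff (fine n M) (n : ℂ) 1 *ᵥ u) / (n : ℝ) ^ 2 := by
  have hn : (0 : ℝ) < (n : ℝ) ^ 2 := pow_pos (by exact_mod_cast Nat.pos_of_ne_zero (NeZero.ne n)) 2
  have hb01 := bsh_mem σ 1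
  rw [EtV]
  simp only [vb_UpT, vb_Up_eq, ← sum_div]
  refine div_le_div_of_nonneg_right ?_ hn.le
  rw [nsq]
  refine sum_sum_le_univ_of_injOn n M (fun s t => emb n M σ b (-(K : ℤ) + s + τ₀) (-(K : ℤ) - 1 + t + τ₁ + bsh σ 1))
    (fun x => ‖_‖ ^ 2) (fun _ => sq_nonneg _) ?_
  intro s hs t ht s' hs' t' ht' h
  simp only [mem_range] at ht hs ht' hs'
  have := emb_injOn n M (σ := σ) (b := b) (a₀ := -(K : ℤ) + τ₀) (a₁ := -(K : ℤ) - 1 + τ₁ + bsh σ 1) (W₀ := 2 * K) (W₁ := 2 * K + 2)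
    h0 h1 (i := -(K : ℤ) + s + τ₀) (j := -(K : ℤ) - 1 + t + τ₁ + bsh σ 1) (i' := -(K : ℤ) + s' + τ₀)
    (j' := -(K : ℤ) - 1 + t' + τ₁ + bsh σ 1) (by omega) (by omega) (by omega) (by omega) (by omega) (by omega) (by omega) (by omega) h
  omega

/-! ## §3 The local Hessian on the translated window and its push-forward -/

/-- **THE LOCAL HESSIAN OF THE TRANSLATED PULL-BACK** (lattice units): for `u` vanishing off `Ω`, product pattern, `1 ≤ L`,
`K = 4L+c+1` with `−n + K ≤ τ_ν ≤ n − K − 1`, `2 ≤ M_ν`: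
`Σ_{Q_{2L+c−1}} 𝟙_W(|d1 UpT|²+|d2 UpT|²) ≤ 2·(Σ_{x∈Ω}|Δu|²)/n⁴ + (32/L²)(‖∂₀u‖²+‖∂₁u‖²)/n² + (16/L⁴)·nsq u`. [folklore] -/
theorem vertexT_local_hessian_le [DecidablePred S] (hu : ∀ x, ¬ blockReg n M S x → u x = 0)
    (hAB : ∀ p : Fin 2 → Bool, S (starBlk M σ b p) ↔ A (p 0) ∧ B (p 1))
    {L c : ℕ} (hL : 1 ≤ L) (hτ₀ : -(n : ℤ) + (4 * L + c + 1) ≤ τ₀) (hτ₀' : τ₀ + (4 * L + c + 1) + 1 ≤ n)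
    (hτ₁ : -(n : ℤ) + (4 * L + c + 1) ≤ τ₁) (hτ₁' : τ₁ + (4 * L + c + 1) + 1 ≤ n) (hM0 : 2 ≤ M 0) (hM1 : 2 ≤ M 1) :
    sqSum (fun i j => indW (WprodT A B τ₀ τ₁) i j * (‖d1 (UpT n M σ b u τ₀ τ₁) i j‖ ^ 2 + ‖d2 (UpT n M σ b u τ₀ τ₁) i j‖ ^ 2))
        (2 * L + c - 1)
      ≤ 2 * ((∑ x ∈ univ.filter (blockReg n M S), ‖(LapS (fine n M) (n : ℂ) *ᵥ u) x‖ ^ 2) / (n : ℝ) ^ 4)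
        + 32 / (L : ℝ) ^ 2 * ((nsq (sdiff (fine n M) (n : ℂ) 0 *ᵥ u) + nsq (sdiff (fine n M) (n : ℂ) 1 *ᵥ u)) / (n : ℝ) ^ 2)
        + 16 / (L : ℝ) ^ 4 * nsq u := by
  set K : ℕ := 4 * L + c + 1 with hKdef
  have hKn : K + 1 ≤ n := by omega
  have hn0 : (0 : ℝ) < n := by exact_mod_cast Nat.pos_of_ne_zero (NeZero.ne n)
  have hW0 : 2 * K + 2 ≤ n * M 0 := by have := Nat.mul_le_mul_left n hM0; omega
  have hW1 : 2 * K + 2 ≤ n * M 1 := by have := Nat.mul_le_mul_left n hM1; omega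
  set U : ℤ → ℤ → ℂ := UpT n M σ b u τ₀ τ₁ with hU
  set G : ℤ → ℤ → ℂ := fun i j => (LapS (fine n M) (n : ℂ) *ᵥ u) (emb n M σ b (i + τ₀) (j + τ₁)) / (n : ℂ) ^ 2 with hG
  have hUW : ∀ i j : ℤ, tIdx i ≤ 4 * (L : ℤ) + c → tIdx j ≤ 4 * (L : ℤ) + c → ¬ WprodT A B τ₀ τ₁ i j → U i j = 0 := by
    intro i j hi hj hW
    have hi' : -(K : ℤ) ≤ i ∧ i < K := by unfold tIdx at hi; split_ifs at hi <;> constructor <;> omega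
    have hj' : -(K : ℤ) ≤ j ∧ j < K := by unfold tIdx at hj; split_ifs at hj <;> constructor <;> omega
    exact hu _ (fun h => hW ((blockReg_embT_iff n M hAB (by omega) (by omega) (by omega) (by omega)).mp h))
  have hEq : ∀ i j : ℤ, tIdx i ≤ 4 * (L : ℤ) + c + 1 → tIdx j ≤ 4 * (L : ℤ) + c + 1 → WprodT A B τ₀ τ₁ i j → lap U i j = G i j := by
    intro i j _ _ _
    have hn2 : (n : ℂ) ^ 2 ≠ 0 := pow_ne_zero 2 (by exact_mod_cast NeZero.ne n)
    show lap U i j = (LapS (fine n M) (n : ℂ) *ᵥ u) (emb n M σ b (i + τ₀) (j + τ₁)) / (n : ℂ) ^ 2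
    rw [hU, lap_UpT, LapS_emb, mul_div_cancel_left₀ _ hn2]
  have hloc := local_hessian_le_shift (WprodT A B τ₀ τ₁) U hL (axisSep_WprodT A B τ₀ τ₁) G hUW hEq
  have hSG : sqSum (fun i j => indW (WprodT A B τ₀ τ₁) i j * ‖G i j‖ ^ 2) K
      ≤ (∑ x ∈ univ.filter (blockReg n M S), ‖(LapS (fine n M) (n : ℂ) *ᵥ u) x‖ ^ 2) / (n : ℝ) ^ 4 := by
    have h : sqSum (fun i j => indW (WprodT A B τ₀ τ₁) i j
          * ‖(LapS (fine n M) (n : ℂ) *ᵥ u) (emb n M σ b (i + τ₀) (j + τ₁)) / (n : ℂ) ^ 2‖ ^ 2) K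
        ≤ ∑ x ∈ univ.filter (blockReg n M S), ‖(LapS (fine n M) (n : ℂ) *ᵥ u) x / (n : ℂ) ^ 2‖ ^ 2 :=
      sqSum_indWT_le n M hAB (fun x => (LapS (fine n M) (n : ℂ) *ᵥ u) x / (n : ℂ) ^ 2) (by omega) (by omega) (by omega) (by omega)
        (by omega) (by omega)
    have e : ∀ x, ‖(LapS (fine n M) (n : ℂ) *ᵥ u) x / (n : ℂ) ^ 2‖ ^ 2 = ‖(LapS (fine n M) (n : ℂ) *ᵥ u) x‖ ^ 2 / (n : ℝ) ^ 4 := by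
      intro x; rw [norm_div, div_pow, norm_pow, Complex.norm_natCast, ← pow_mul]
    have e2 : (fun i j => indW (WprodT A B τ₀ τ₁) i j * ‖G i j‖ ^ 2)
        = (fun i j => indW (WprodT A B τ₀ τ₁) i j * (‖(LapS (fine n M) (n : ℂ) *ᵥ u) (emb n M σ b (i + τ₀) (j + τ₁))‖ ^ 2 / (n : ℝ) ^ 4)) := by
      funext i j; simp only [hG, e]
    simp only [e] at h
    rw [e2, Finset.sum_div]
    exact h
  have hEt : Et U K ≤ (nsq (sdiff (fine n M) (n : ℂ) 0 *ᵥ u) + nsq (sdiff (fine n M) (n : ℂ) 1 *ᵥ u)) / (n : ℝ) ^ 2 := by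
    rw [Et_eq_rect, add_div]
    exact add_le_add (EtH_UpT_le n M u hW0 (by omega)) (EtV_UpT_le n M u (by omega) hW1)
  have hS : sqSum (fun i j => ‖U i j‖ ^ 2) K ≤ nsq u := sqSum_normSq_UpT_le n M u (by omega) (by omega)
  refine hloc.trans ?_
  gcongr

/-- the PUSHED-FORWARD PLATEAU INDICATOR of the translated window. [folklore] -/
def plainWT (v : (Fin 2 → Bool) × Tor M) (A B : Bool → Prop) [DecidablePred A] [DecidablePred B] (τ₀ τ₁ : ℤ) (P : ℕ)
    (x : Tor (fine n M)) : ℝ :=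
  ∑ t ∈ range (2 * P), ∑ s ∈ range (2 * P),
    if x = emb n M v.1 v.2 (-(P : ℤ) + s + τ₀) (-(P : ℤ) + t + τ₁)
      then indW (WprodT A B τ₀ τ₁) (-(P : ℤ) + s) (-(P : ℤ) + t) else 0

omit [NeZero n] hM in
/-- `0 ≤ plainWT`. [folklore] -/
theorem plainWT_nonneg (v : (Fin 2 → Bool) × Tor M) (A B : Bool → Prop) [DecidablePred A] [DecidablePred B] (τ₀ τ₁ : ℤ) (P : ℕ)
    (x : Tor (fine n M)) : 0 ≤ plainWT n M v A B τ₀ τ₁ P x := by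
  refine sum_nonneg fun t _ => sum_nonneg fun s _ => ?_
  split_ifs
  · exact (indW_mem _ _ _).1
  · exact le_rfl

/-- **EXCHANGE OF SUMS** for `plainWT`. [folklore] -/
theorem sum_plainWT_mul (v : (Fin 2 → Bool) × Tor M) (A B : Bool → Prop) [DecidablePred A] [DecidablePred B] (τ₀ τ₁ : ℤ) (P : ℕ)
    (F : Tor (fine n M) → ℝ) :
    ∑ x, plainWT n M v A B τ₀ τ₁ P x * F x
      = ∑ t ∈ range (2 * P), ∑ s ∈ range (2 * P),
          indW (WprodT A B τ₀ τ₁) (-(P : ℤ) + s) (-(P : ℤ) + t) * F (emb n M v.1 v.2 (-(P : ℤ) + s + τ₀) (-(P : ℤ) + t + τ₁)) := by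
  simp only [plainWT, sum_mul]
  rw [sum_comm]
  refine sum_congr rfl fun t _ => ?_
  rw [sum_comm]
  refine sum_congr rfl fun s _ => ?_
  simp only [ite_mul, zero_mul, sum_ite_eq', mem_univ, if_true]

/-- **THE UNWEIGHTED HESSIAN CHARGED TO A TRANSLATED WINDOW**: for `u` vanishing off `Ω`, product pattern, `1 ≤ L`, `K = 4L+c+1` with
`−n + K ≤ τ_ν ≤ n − K − 1`, `2 ≤ M_ν`, plateau `P = 2L + c − 1`:
`Σ_μ Σ_x plainWT(x)·|(∂ᴴ_μ∂_μ u)(x)|² ≤ 2·Σ_{x∈Ω}|Δu|² + 32(n/L)²(‖∂₀u‖²+‖∂₁u‖²) + 16(n/L)⁴·nsq u`. [folklore] -/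
theorem vertexT_plain_hessian_le [DecidablePred S] (hu : ∀ x, ¬ blockReg n M S x → u x = 0)
    (hAB : ∀ p : Fin 2 → Bool, S (starBlk M σ b p) ↔ A (p 0) ∧ B (p 1))
    {L c : ℕ} (hL : 1 ≤ L) (hτ₀ : -(n : ℤ) + (4 * L + c + 1) ≤ τ₀) (hτ₀' : τ₀ + (4 * L + c + 1) + 1 ≤ n)
    (hτ₁ : -(n : ℤ) + (4 * L + c + 1) ≤ τ₁) (hτ₁' : τ₁ + (4 * L + c + 1) + 1 ≤ n) (hM0 : 2 ≤ M 0) (hM1 : 2 ≤ M 1) :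
    ∑ μ, ∑ x, plainWT n M (σ, b) A B τ₀ τ₁ (2 * L + c - 1) x * ‖(Pdir (fine n M) (n : ℂ) μ *ᵥ u) x‖ ^ 2
      ≤ 2 * ∑ x ∈ univ.filter (blockReg n M S), ‖(LapS (fine n M) (n : ℂ) *ᵥ u) x‖ ^ 2
        + 32 * ((n : ℝ) / L) ^ 2 * (nsq (sdiff (fine n M) (n : ℂ) 0 *ᵥ u) + nsq (sdiff (fine n M) (n : ℂ) 1 *ᵥ u))
        + 16 * ((n : ℝ) / L) ^ 4 * nsq u := by
  set P : ℕ := 2 * L + c - 1 with hP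
  have hn0 : (0 : ℝ) < n := by exact_mod_cast Nat.pos_of_ne_zero (NeZero.ne n)
  have hL0 : (0 : ℝ) < L := by exact_mod_cast hL
  have hloc := vertexT_local_hessian_le n M hu hAB hL hτ₀ hτ₀' hτ₁ hτ₁' hM0 hM1
  have step1 : ∑ μ, ∑ x, plainWT n M (σ, b) A B τ₀ τ₁ P x * ‖(Pdir (fine n M) (n : ℂ) μ *ᵥ u) x‖ ^ 2
      = (n : ℝ) ^ 4 * sqSum (fun i j => indW (WprodT A B τ₀ τ₁) i j
          * (‖d1 (UpT n M σ b u τ₀ τ₁) i j‖ ^ 2 + ‖d2 (UpT n M σ b u τ₀ τ₁) i j‖ ^ 2)) P := by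
    rw [Fin.sum_univ_two, sum_plainWT_mul, sum_plainWT_mul, ← sum_add_distrib, sqSum, mul_sum]
    refine sum_congr rfl fun t _ => ?_
    rw [← sum_add_distrib, mul_sum]
    refine sum_congr rfl fun s _ => ?_
    rw [Pdir_embT_fst, Pdir_embT_snd, norm_mul, norm_mul, norm_neg, norm_pow, Complex.norm_natCast, mul_pow, mul_pow, ← pow_mul]
    ring
  rw [step1]
  have e : (n : ℝ) ^ 4 * (2 * ((∑ x ∈ univ.filter (blockReg n M S), ‖(LapS (fine n M) (n : ℂ) *ᵥ u) x‖ ^ 2) / (n : ℝ) ^ 4)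
        + 32 / (L : ℝ) ^ 2 * ((nsq (sdiff (fine n M) (n : ℂ) 0 *ᵥ u) + nsq (sdiff (fine n M) (n : ℂ) 1 *ᵥ u)) / (n : ℝ) ^ 2)
        + 16 / (L : ℝ) ^ 4 * nsq u)
      = 2 * ∑ x ∈ univ.filter (blockReg n M S), ‖(LapS (fine n M) (n : ℂ) *ᵥ u) x‖ ^ 2
        + 32 * ((n : ℝ) / L) ^ 2 * (nsq (sdiff (fine n M) (n : ℂ) 0 *ᵥ u) + nsq (sdiff (fine n M) (n : ℂ) 1 *ᵥ u))
        + 16 * ((n : ℝ) / L) ^ 4 * nsq u := by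
    field_simp
  rw [← e]
  exact mul_le_mul_of_nonneg_left hloc (by positivity)

variable (S) (a' : ℝ)

/-- **THE UNWEIGHTED HESSIAN OF THE DIRICHLET SOLUTION CHARGED TO A TRANSLATED WINDOW**: for `u = solExt n M a′ Ω f`,
`Σ_μ Σ_x plainWT(x)·|(∂ᴴ_μ∂_μ u)(x)|² ≤ (4(1+(a′γ′⁻¹)²) + 32(n/L)²γ′⁻¹ + 16(n/L)⁴γ′⁻²)·‖f‖²`. [folklore] -/
theorem plainT_hessian_solExt_le [DecidablePred S]
    (hAB : ∀ p : Fin 2 → Bool, S (starBlk M σ b p) ↔ A (p 0) ∧ B (p 1))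
    {L c : ℕ} (hL : 1 ≤ L) (hτ₀ : -(n : ℤ) + (4 * L + c + 1) ≤ τ₀) (hτ₀' : τ₀ + (4 * L + c + 1) + 1 ≤ n)
    (hτ₁ : -(n : ℤ) + (4 * L + c + 1) ≤ τ₁) (hτ₁' : τ₁ + (4 * L + c + 1) + 1 ≤ n) (hM0 : 2 ≤ M 0) (hM1 : 2 ≤ M 1) (ha' : 0 < a')
    (f : {y // blockReg n M S y} → ℂ) :
    ∑ μ, ∑ x, plainWT n M (σ, b) A B τ₀ τ₁ (2 * L + c - 1) x
        * ‖(Pdir (fine n M) (n : ℂ) μ *ᵥ solExt n M a' (blockReg n M S) f) x‖ ^ 2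
      ≤ (4 * (1 + (a' * (gammaPs 2 a')⁻¹) ^ 2) + 32 * ((n : ℝ) / L) ^ 2 * (gammaPs 2 a')⁻¹
          + 16 * ((n : ℝ) / L) ^ 4 * ((gammaPs 2 a')⁻¹) ^ 2) * nsq f := by
  set u := solExt n M a' (blockReg n M S) f with hu
  have hu0 : ∀ x, ¬ blockReg n M S x → u x = 0 := fun x hx => solExt_apply_of_not n M a' _ f hx
  have hγp := (gammaPs_pos (d := 2) (a' := a')).1
  have hE : nsq (sdiff (fine n M) (n : ℂ) 0 *ᵥ u) + nsq (sdiff (fine n M) (n : ℂ) 1 *ᵥ u) ≤ (gammaPs 2 a')⁻¹ * nsq f := by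
    have h := dirichlet_solExt_le n M a' (blockReg n M S) ha' f
    rw [dirichlet, Fin.sum_univ_two] at h
    exact h
  have hB : ∑ x ∈ univ.filter (blockReg n M S), ‖(LapS (fine n M) (n : ℂ) *ᵥ u) x‖ ^ 2 ≤ 2 * (1 + (a' * (gammaPs 2 a')⁻¹) ^ 2) * nsq f := by
    rw [Finset.sum_subtype (univ.filter (blockReg n M S)) (p := blockReg n M S) (fun x => by simp)
      (fun x => ‖(LapS (fine n M) (n : ℂ) *ᵥ u) x‖ ^ 2)]
    exact sum_normSq_LapS_solExt_le n M a' (blockReg n M S) ha' f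
  have hN : nsq u ≤ ((gammaPs 2 a')⁻¹) ^ 2 * nsq f := nsq_solExt_le n M a' (blockReg n M S) ha' f
  have hf0 := nsq_nonneg f
  have h := vertexT_plain_hessian_le n M (σ := σ) (b := b) (A := A) (B := B) hu0 hAB hL hτ₀ hτ₀' hτ₁ hτ₁' hM0 hM1
  refine h.trans ?_
  have hn0 : (0 : ℝ) ≤ ((n : ℝ) / L) ^ 2 := sq_nonneg _
  have hn4 : (0 : ℝ) ≤ ((n : ℝ) / L) ^ 4 := by positivity
  nlinarith [mul_le_mul_of_nonneg_left hE (by positivity : (0 : ℝ) ≤ 32 * ((n : ℝ) / L) ^ 2),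
    mul_le_mul_of_nonneg_left hN (by positivity : (0 : ℝ) ≤ 16 * ((n : ℝ) / L) ^ 4)]

end Sums

end Summit.QuantumFields.BalabanUV.Beta.GAN24.DirichletVertexLocalT

end
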